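import Mathlib
import HarnessLib
import Summits.NavierStokesRegularity.NavierStokesRegularity.Theorems.UnthreadedDoorAntidynamoWallSymmetricCoreMild

/-!
# Route `UnthreadedDoor` / `ThreadingFlux`, crux `PoloidalLiouville` (stmt-NavierStokesRegularity-1222), antidynamo v2 skeleton (sha16 `4ebf5683127b`),
# WALL `stub_scalarLiouville`: THE CENTRALLY SYMMETRIC CORE IS GENUINELY MILD — even vorticity about ANY centre at ONE instant

Support file (seat leafhand-ns-unthreadeddoor-2 g2, cell decomp-ns), `--supports stmt-NavierStokesRegularity-1222 --as helper`; theorems only.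

The point reflection `y ↦ −y` (`LinearIsometryEquiv.neg ℝ`) has determinant `−1` on `ℝ³` and fixes no non-zero vector, so the pseudovector symmetry under it is
EVENNESS of the vorticity, and `…WallSymmetricCoreMild` specialises to:

* ★★★ `curl_eq_zero_or_odd_mild_of_curl_even_slice` — if the vorticity of a flow of the wall's class (bounded ancient mild, duality sense; measurable slices;
  jointly smooth; vorticity tangent to the spheres about `x₀`) is EVEN about SOME centre `x₁` at ONE instant (`curl v(t₁)(x₁ − y) = curl v(t₁)(x₁ + y)`), then
  EITHER `curl v ≡ 0`, OR `v` is ODD about `x₀` at every time (`v(t, x₀ − y) = −v(t, x₀ + y)`, so `v(t, x₀) = 0`) AND `v` ITSELF is a bounded ancient MILD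
  solution in the sense of KNSS 2009 §4 (i) (Oseen integral identity for all `s < t < 0`; no parasitic drift).

So the «centrally symmetric core» of the g0/g1 residual list is: ODD, MILD, bounded ancient solutions with vorticity tangent to the spheres about the centre
of symmetry — a statement entirely inside print's class, entered from ONE instant and ANY centre of evenness.

HONEST LABEL: a corollary; nothing here proves `stub_scalarLiouville`, `PoloidalLiouville` (1222), or bears on Navier–Stokes regularity; no summit statement is
proved. [folklore] [cite: KochNadirashviliSereginSverak2009, §1 p. 3, §4 (i)–(ii), Thm 5.2 (arXiv:0709.3599 pp. 3, 8–10)]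
-/

noncomputable section

-- the summit and its single sub-problem share the name (CONVENTIONS §1)
set_option linter.dupNamespace false

open scoped Topology InnerProductSpace RealInnerProductSpace ContDiff
open Filter Set Function Metric MeasureTheory
open Literature.Analysis Literature.Analysis.FluidPDE

namespace Summit.NavierStokesRegularity.NavierStokesRegularity.Theorems.PoloidalLiouville.Antidynamo

open Summit.NavierStokesRegularity.NavierStokesRegularity.Theorems.PoloidalLiouville.NetFlux (E3)

namespace OneInstant

/-- The point reflection of `ℝ³` has determinant `−1`. [folklore] -/
theorem det_neg_eq :
    ((LinearIsometryEquiv.neg ℝ : EuclideanSpace ℝ (Fin 3) ≃ₗᵢ[ℝ] EuclideanSpace ℝ (Fin 3)) :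
      EuclideanSpace ℝ (Fin 3) →L[ℝ] EuclideanSpace ℝ (Fin 3)).det = -1 := by
  have e : (((LinearIsometryEquiv.neg ℝ : EuclideanSpace ℝ (Fin 3) ≃ₗᵢ[ℝ] EuclideanSpace ℝ (Fin 3)) :
      EuclideanSpace ℝ (Fin 3) →L[ℝ] EuclideanSpace ℝ (Fin 3)) : EuclideanSpace ℝ (Fin 3) →ₗ[ℝ] EuclideanSpace ℝ (Fin 3)) =
      (-1 : ℝ) • LinearMap.id := by
    ext y i
    simp
  rw [ContinuousLinearMap.det, e, LinearMap.det_smul, LinearMap.det_id, finrank_euclideanSpace_fin]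
  norm_num

/-- The point reflection fixes no non-zero vector. [folklore] -/
theorem eq_zero_of_neg_fixed (d : EuclideanSpace ℝ (Fin 3))
    (h : (LinearIsometryEquiv.neg ℝ : EuclideanSpace ℝ (Fin 3) ≃ₗᵢ[ℝ] EuclideanSpace ℝ (Fin 3)) d = d) : d = 0 := by
  rw [LinearIsometryEquiv.coe_neg] at h
  have h2 : (2 : ℝ) • d = 0 := by
    rw [two_smul]
    nth_rewrite 1 [← h]
    exact neg_add_cancel d
  exact (smul_eq_zero.1 h2).resolve_left (by norm_num)

/-- ★★★ **EVEN VORTICITY ABOUT ANY CENTRE AT ONE INSTANT ⇒ IRROTATIONAL, OR ODD ABOUT `x₀` AND GENUINELY MILD.** [cite: KochNadirashviliSereginSverak2009, §1 p. 3, §4 (i)–(ii) (arXiv:0709.3599 pp. 3, 8)] -/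
theorem curl_eq_zero_or_odd_mild_of_curl_even_slice
    (v : ℝ → EuclideanSpace ℝ (Fin 3) → EuclideanSpace ℝ (Fin 3)) (x₀ : EuclideanSpace ℝ (Fin 3))
    (hB : Literature.Analysis.FluidPDE.IsBoundedAncientMildSolution 1 v)
    (hm : ∀ t < 0, AEStronglyMeasurable (v t) volume)
    (hsm : ContDiffOn ℝ (⊤ : ℕ∞) (Function.uncurry v) (Set.Iio 0 ×ˢ Set.univ))
    (hun : ∀ t < 0, ∀ x, ⟪x - x₀, curl (v t) x⟫ = 0)
    (x₁ : EuclideanSpace ℝ (Fin 3)) {t₁ : ℝ} (ht₁ : t₁ < 0)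
    (hev : ∀ y, curl (v t₁) (x₁ - y) = curl (v t₁) (x₁ + y)) :
    (∀ t < 0, ∀ x, curl (v t) x = 0) ∨
      ((∀ t < 0, ∀ y, v t (x₀ - y) = -v t (x₀ + y)) ∧ (∀ t < 0, v t x₀ = 0) ∧
        ∀ s t : ℝ, s < t → t < 0 → ∀ x,
          v t x = UnboundedOperators.heatExtension (v s) (t - s) x - oseenDuhamel 1 s v v t x) := by
  set R : EuclideanSpace ℝ (Fin 3) ≃ₗᵢ[ℝ] EuclideanSpace ℝ (Fin 3) := LinearIsometryEquiv.neg ℝ with hRdef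
  have hRy : ∀ y : EuclideanSpace ℝ (Fin 3), R y = -y := fun y => rfl
  have hsym₁ : ∀ y, curl (v t₁) (x₁ + R y) =
      (R : EuclideanSpace ℝ (Fin 3) →L[ℝ] EuclideanSpace ℝ (Fin 3)).det • R (curl (v t₁) (x₁ + y)) := fun y => by
    rw [hRdef, det_neg_eq, hRy, hRy, ← sub_eq_add_neg, hev y, neg_one_smul, neg_neg]
  rcases curl_eq_zero_or_oseenMild_of_curl_symmetric_slice v x₀ hB hm hsm hun R
      (fun d hd => eq_zero_of_neg_fixed d hd) x₁ ht₁ hsym₁ with h | ⟨heqv, hx0, hmild⟩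
  · exact Or.inl h
  · refine Or.inr ⟨fun t ht y => ?_, hx0, hmild⟩
    have h := heqv t ht y
    rw [hRy, hRy, ← sub_eq_add_neg] at h
    exact h

end OneInstant

end Summit.NavierStokesRegularity.NavierStokesRegularity.Theorems.PoloidalLiouville.Antidynamo

end
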